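import Literature.MathematicalPhysics.QuantumFieldTheory.Balaban1983to89.T3AlphaInputsAC
import Literature.MathematicalPhysics.QuantumFieldTheory.Balaban1983to89.B10Eq39CollarVolume
import Summits.QuantumFields.YangMills.Theorems.UnitScaleTiltProp7BlockDistanceWeights
import HarnessLib

/-!
# S1a · UV3-NODE §69.2 row δ1 — THE LOCAL COVER COUNT: `Witness.cover`'s per-footprint-site SHAPE for the (α)-socket's activity system, from `LocCover`
# (per fine site), `EnlBounded` (print's `X̃`) and the BLOCK STRUCTURE of the localisation domains ([Balaban1985UV3] (24) p.262 «Localizations X are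
# connected unions of big blocks» — the ONE row the socket lacks, taken INLINE in the tree's own words `B10Eq38TorusDomains.IsBlockUnion (M₁·L^i) Y`)

Cell `ym3-torus` (YM ladder rung R3 = continuum `SU(2)` Yang–Mills on the three-torus — a RUNG: NOT d = 4, NOT infinite volume, NOT a mass gap, NOT Clay).
Width seat «width 8» `ym3-torus-px8` (gen 23), FREE px helper on crux `stmt-QuantumFields-20520`, count-neutral, DEFINITION-FREE, default heartbeats; the δ1 row of
the (m2) door «(α)-socket ⟹ `BalabanUVClass.Witness`» (UV3-NODE §69.2: «`cover : ∀ y : Site P k, Σ_{X ∋ y} wt X·e^{−κ len X} ≤ Ccov` — from per-FINE-site `LocCover`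
the per-FOOTPRINT sum is off by the block volume … with the block-structure clause the count is print's (46)»).  This file IS that count, by kernel.

WHAT (run `K` of a `T3Family`, level `k ≤ K`, averaging-free; the domain index of ✓`…S1aAlphaActivitySystem.activitySystem_of_alpha` = tagged pairs `⟨i, Y⟩`,
`i ∈ [1, k]`, `Y ∈ D.Loc K k triv i`, footprint of `⟨i, Y⟩` = the level-`k` sites `B^k`-under the enlargement `D.enl K i Y`, size weight `(L^{−(k−i)})⁴`):
* §1 `sum_le_of_local_volume` — LOCALISED DOUBLE COUNTING (pure finite bookkeeping): if every member of a sub-family `T ⊆ Loc` has `≥ N` sites in a window `S`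
  and the per-site sums of `Loc` are `≤ C`, then `Σ_{Y ∈ T} f Y ≤ C·|S|∕N` ((45)–(46) p.267 on a window instead of the torus; the tree's global twin is
  ✓`…SocketLevelsAlpha.sum_loc_exp_le_of_locCover_of_volume`).
* §2 torus geometry (`Setup` carrier, any `Params`): `pow_le_card_fiber` (a cube whose side divides the period has `≥ s^d` sites — the FULL big block); the `k`-block
  diameter `≤ d(L^k − 1)` is the tree's ✓`Prop7BlockDistanceWeights.tdist_le_of_iterBlockOf_eq` (imported, not restated).
* §3 `sum_Icc_pow_sub_le`, `sum_Icc_inv_pow_sub_le_two` — (46)'s geometric factor `Σ_{i=1}^{k} L^{−(k−i)} ≤ 2`.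
* §4 `bigBlock_dvd_period` (`M₁ ∣ 2L^m ⟹ M₁L^i ∣ 2L^{m+K}`) and ★★`localCount_le` — THE LOCAL COUNT AT TERM LEVEL `i`: the level-`i` domains whose enlargement projects
  onto a given level-`k` site have `Σ e^{−κ₁𝓛} ≤ max C′ 0·(7 + 2r + 18M₁)³·L^{3(k−i)}` (every such domain contains a FULL big block — `(M₁L^i)³` sites — inside the ℓ¹
  window of radius `(3 + r + 9M₁)L^k` around the block, whose `≤ ((7 + 2r + 18M₁)L^k)³` sites carry per-site sums `≤ C′`: ✓`card_ball_floor_le`, ✓`tdist_le_blockDist_add'`,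
  ✓`tdist_le_of_cubeIdx_eq`); §5 ★★★`coverShape_of_alpha` — `Witness.cover`'s SHAPE: `Σ_{⟨i,Y⟩ : y under enl Y} (L^{−(k−i)})⁴·e^{−κ₁𝓛(Y)} ≤ 2·max C′ 0·(7 + 2r + 18M₁)³` for EVERY level-`k` site
  `y`, uniformly in `k`, `K` — times the level-independent factor `max C 0·θBal(K−k+1)²` of ✓`activitySystem_of_alpha`'s weights this is the door's `Ccov`
  (`Ccov_j ≤ C₀θ(j)²`, `BalabanAdmissibleClassParams.cover`).  Stated over the tagged `Finset.sigma` (the door numbers it by `equivFin` as ✓p819182 does).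

HYPOTHESES AND THEIR SOURCES (all HYPOTHESIS schemas on a GIVEN `D`, never asserted): `LocCover D κ₁ C′` ((45) p.267, typed), `EnlBounded D M₁ r` (p.263 `X̃`, typed; `r ≥ 0`),
`1 ≤ M₁`, `M₁ ∣ 2·L^m` (print's torus is tiled by its big blocks at every scale; the tree's `Params` has `2L^{m+K}` sites per direction, so this is the divisibility that
makes big blocks full cubes — cf. `B10Eq38TorusDomains` header (i)), and INLINE `∀ Y ∈ D.Loc K k triv i, IsBlockUnion (M₁·L^i) Y` = (24) p.262 — the δ1 row itself, for the
(α)-socket's interface pen to add as a schema (`LocBlockUnion`, UV3-NODE §69.2∕§69.9 style); it IMPLIES the socket's `LocBlockVolume` under the same divisibility.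

WHAT THIS FILE IS NOT: no `Witness` is built; `diam_foot` (δ4: `treeLen` vs geometry) is NOT touched; nothing of Bałaban's is proved — (45)–(46) are the SOURCES of the
schemas, the count is lattice bookkeeping; S1a(ᴴ), crux 20520 and `YM3TorusSU2` are NOT proved; no registered stub is closed; the Yang–Mills mass gap is NOT proved.
Sorry-free, axioms standard.  References: T. Bałaban, CMP **102** (1985) 255–275 [Balaban1985UV3] ((24) p.262, p.263, (44)–(46) p.267); CMP **109** (1987) [Balaban1987RG1] ((0.1) p.252).
-/

set_option autoImplicit false

noncomputable section

namespace Summit.QuantumFields.YangMills.Theorems.FluctuationComparisonRegPrIntLS1aAlphaLocalCover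

open Finset
open scoped BigOperators
open Literature.MathematicalPhysics.QuantumFieldTheory.Balaban1983to89
open T3ContinuumYM3Torus T3UnitScaleTilt T3AlphaInputsAC
open B3Ineq314Cubes (cubeIdx fiber mem_fiber)
open B10Eq38TorusDomains (IsBlockUnion blockDist bdist)
open B10Eq39CollarVolume (ball mem_ball card_ball_le card_ball_floor_le tdist_le_of_cubeIdx_eq tdist_le_blockDist_add')
open B3Taylor310LocalRemainder (tdist_triangle tdist_comm)
open B5Eq118OneStroke (iterBlockOf)
open Summit.QuantumFields.YangMills.Theorems.Prop7BlockDistanceWeights (tdist_le_of_iterBlockOf_eq)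

/-! ## §1 Localised double counting (pure finite bookkeeping) -/

section DoubleCount

variable {X : Type*}

/-- **LOCALISED DOUBLE COUNTING** ((45)–(46) p.267 «summation over all Y_j with y fixed … Summation over y gives the factor …», read on a WINDOW `S` instead of the
whole torus): if every listed domain `Y ∈ T` has at least `N > 0` sites inside `S`, and the per-site sums `Σ_{Y ∈ Loc, Y ∋ x} f Y` are `≤ C` (all `f ≥ 0`, `T ⊆ Loc`),
then `Σ_{Y ∈ T} f Y ≤ C·|S|∕N`. [cite: Balaban1985UV3, (45)-(46) p.267] -/
theorem sum_le_of_local_volume (Loc T : Finset (Set X)) (hT : T ⊆ Loc) (f : Set X → ℝ) (hf : ∀ Y, 0 ≤ f Y) (S : Finset X)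
    {N C : ℝ} (hN : 0 < N) (hvol : ∀ Y ∈ T, N ≤ ∑ x ∈ S, Y.indicator (fun _ => (1 : ℝ)) x)
    (hcov : ∀ x : X, ∑ Y ∈ Loc, Y.indicator (fun _ => f Y) x ≤ C) :
    ∑ Y ∈ T, f Y ≤ C * S.card / N := by
  classical
  rw [le_div_iff₀ hN]
  -- `N·f(Y) ≤ Σ_{x ∈ S} 1_Y(x)·f(Y)` for every `Y ∈ T`
  have hdom : ∀ Y ∈ T, f Y * N ≤ ∑ x ∈ S, Y.indicator (fun _ => f Y) x := by
    intro Y hY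
    have hsum : ∑ x ∈ S, Y.indicator (fun _ => f Y) x = (∑ x ∈ S, Y.indicator (fun _ => (1 : ℝ)) x) * f Y := by
      rw [Finset.sum_mul]
      refine Finset.sum_congr rfl fun x _ => ?_
      by_cases hx : x ∈ Y
      · simp [Set.indicator_of_mem hx]
      · simp [Set.indicator_of_notMem hx]
    rw [hsum, mul_comm]
    exact mul_le_mul_of_nonneg_right (hvol Y hY) (hf Y)
  calc (∑ Y ∈ T, f Y) * N = ∑ Y ∈ T, f Y * N := Finset.sum_mul _ _ _
    _ ≤ ∑ Y ∈ T, ∑ x ∈ S, Y.indicator (fun _ => f Y) x := Finset.sum_le_sum hdom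
    _ = ∑ x ∈ S, ∑ Y ∈ T, Y.indicator (fun _ => f Y) x := Finset.sum_comm
    _ ≤ ∑ x ∈ S, ∑ Y ∈ Loc, Y.indicator (fun _ => f Y) x := by
        refine Finset.sum_le_sum fun x _ => Finset.sum_le_sum_of_subset_of_nonneg hT fun Y _ _ => ?_
        exact Set.indicator_nonneg (fun _ _ => hf Y) _
    _ ≤ ∑ _x ∈ S, C := Finset.sum_le_sum fun x _ => hcov x
    _ = C * S.card := by rw [Finset.sum_const, nsmul_eq_mul, mul_comm]

end DoubleCount

/-! ## §2 Geometry of the fine torus of run `K`: block points, cubes, balls -/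

section Geometry

variable {P : Params}

/-- **A FULL CUBE HAS `s^d` SITES**: if the side `s` divides the period `N` of the fine torus, the cube of side `s` containing `x` has at least (hence exactly) `s^d` sites
(the translates `c_μ s + t_μ`, `t ∈ [0,s)^d`, are distinct sites of that cube; the tree's ✓`B3Ineq314Cubes.card_fiber_le` is the other inequality). [cite: Balaban1985UV3, (24) p.262] -/
theorem pow_le_card_fiber {s : ℕ} (hs : 0 < s) (hdiv : s ∣ P.sitesPerDir 0) (x : Site P 0) :
    s ^ P.d ≤ (fiber s (cubeIdx s x) : Finset (Site P 0)).card := by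
  classical
  obtain ⟨q, hq⟩ := hdiv
  -- the cube label is below `q` coordinatewise
  have hc : ∀ μ, (x μ).val / s < q := fun μ => by
    exact Nat.div_lt_of_lt_mul (lt_of_lt_of_eq (ZMod.val_lt _) hq)
  -- the injection `t ↦ (c_μ s + t_μ)_μ`
  let g : (Fin P.d → Fin s) → Site P 0 := fun t μ => (((x μ).val / s * s + (t μ : ℕ) : ℕ) : ZMod (P.sitesPerDir 0))
  have hlt : ∀ (t : Fin P.d → Fin s) μ, (x μ).val / s * s + (t μ : ℕ) < P.sitesPerDir 0 := fun t μ => by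
    have h1 : (x μ).val / s * s + (t μ : ℕ) < ((x μ).val / s + 1) * s := by
      have := (t μ).isLt; nlinarith
    have h2 : ((x μ).val / s + 1) * s ≤ q * s := Nat.mul_le_mul_right _ (hc μ)
    have h3 : P.sitesPerDir 0 = q * s := by rw [hq, mul_comm]
    omega
  have hval : ∀ (t : Fin P.d → Fin s) μ, (g t μ).val = (x μ).val / s * s + (t μ : ℕ) := fun t μ => by
    show ((((x μ).val / s * s + (t μ : ℕ) : ℕ) : ZMod (P.sitesPerDir 0))).val = _
    rw [ZMod.val_natCast, Nat.mod_eq_of_lt (hlt t μ)]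
  have hmem : ∀ t, g t ∈ (fiber s (cubeIdx s x) : Finset (Site P 0)) := fun t => by
    rw [mem_fiber]
    funext μ
    show (g t μ).val / s = (x μ).val / s
    rw [hval, Nat.add_comm, Nat.add_mul_div_right _ _ hs, Nat.div_eq_of_lt (t μ).isLt, zero_add]
  have hinj : Function.Injective g := fun t t' htt' => by
    funext μ
    have h := congrArg (fun z : Site P 0 => (z μ).val) htt'
    simp only [hval] at h
    exact Fin.ext (by omega)
  calc s ^ P.d = (Finset.univ : Finset (Fin P.d → Fin s)).card := by simp
    _ = ((Finset.univ : Finset (Fin P.d → Fin s)).image g).card := (Finset.card_image_of_injective _ hinj).symm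
    _ ≤ (fiber s (cubeIdx s x) : Finset (Site P 0)).card :=
        Finset.card_le_card fun z hz => by obtain ⟨t, -, rfl⟩ := Finset.mem_image.mp hz; exact hmem t

end Geometry

/-! ## §3 The geometric factor of (46) -/

section Geom

/-- `Σ_{i=1}^{k} x^{k−i} ≤ 1∕(1 − x)` for `0 ≤ x < 1` ((46) p.267 «summation over j = 1, …, k gives …»). [cite: Balaban1985UV3, (46) p.267] -/
theorem sum_Icc_pow_sub_le {x : ℝ} (hx0 : 0 ≤ x) (hx1 : x < 1) :
    ∀ k : ℕ, ∑ i ∈ Finset.Icc 1 k, x ^ (k - i) ≤ 1 / (1 - x)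
  | 0 => by
    rw [show Finset.Icc 1 0 = ∅ by rfl, Finset.sum_empty]
    exact div_nonneg zero_le_one (by linarith)
  | k + 1 => by
    rw [Finset.sum_Icc_succ_top (by omega), Nat.sub_self, pow_zero]
    have hrec := sum_Icc_pow_sub_le hx0 hx1 k
    have hmul : ∑ i ∈ Finset.Icc 1 k, x ^ (k + 1 - i) = x * ∑ i ∈ Finset.Icc 1 k, x ^ (k - i) := by
      rw [Finset.mul_sum]
      refine Finset.sum_congr rfl fun i hi => ?_
      rw [Finset.mem_Icc] at hi
      rw [show k + 1 - i = (k - i) + 1 by omega, pow_succ, mul_comm]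
    rw [hmul]
    have h1x : 0 < 1 - x := by linarith
    have hx' : x * ∑ i ∈ Finset.Icc 1 k, x ^ (k - i) ≤ x * (1 / (1 - x)) := mul_le_mul_of_nonneg_left hrec hx0
    have heq : x * (1 / (1 - x)) + 1 = 1 / (1 - x) := by field_simp; ring
    linarith

/-- For `L ≥ 2`: `Σ_{i=1}^{k} (L⁻¹)^{k−i} ≤ 2`. [cite: Balaban1985UV3, (46) p.267] -/
theorem sum_Icc_inv_pow_sub_le_two {L : ℝ} (hL : 2 ≤ L) (k : ℕ) : ∑ i ∈ Finset.Icc 1 k, (L⁻¹) ^ (k - i) ≤ 2 := by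
  have hL0 : 0 < L := by linarith
  have hx0 : 0 ≤ L⁻¹ := inv_nonneg.mpr hL0.le
  have hx1 : L⁻¹ ≤ 1 / 2 := by rw [inv_eq_one_div]; exact one_div_le_one_div_of_le (by norm_num) hL
  refine (sum_Icc_pow_sub_le hx0 (by linarith) k).trans ?_
  rw [div_le_iff₀ (by linarith)]
  linarith

end Geom

/-! ## §4 The local count at one term level -/

section Cover

variable {F : T3Family} {γ : ℝ}

/-- Divisibility bookkeeping: if `M₁ ∣ 2·L^m` then every big-block side `M₁·L^i`, `i ≤ K`, divides the period `2·L^{m+K}` of run `K`'s fine torus (big blocks are full cubes).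
[cite: Balaban1985UV3, (24) p.262] -/
theorem bigBlock_dvd_period {M₁ K i : ℕ} (hM : M₁ ∣ 2 * F.L ^ F.m) (hi : i ≤ K) : M₁ * F.L ^ i ∣ (F.P K).sitesPerDir 0 := by
  show M₁ * F.L ^ i ∣ 2 * F.L ^ (F.m + K - 0)
  obtain ⟨q, hq⟩ := hM
  refine ⟨q * F.L ^ (K - i), ?_⟩
  rw [Nat.sub_zero, show F.m + K = F.m + i + (K - i) by omega, pow_add, pow_add]
  calc 2 * (F.L ^ F.m * F.L ^ i * F.L ^ (K - i)) = (2 * F.L ^ F.m) * F.L ^ i * F.L ^ (K - i) := by ring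
    _ = M₁ * q * F.L ^ i * F.L ^ (K - i) := by rw [hq]
    _ = M₁ * F.L ^ i * (q * F.L ^ (K - i)) := by ring

open Classical in
/-- ★★ **THE LOCAL COUNT AT TERM LEVEL `i`** ((45) p.267 read per level-`k` footprint site): run `K`, level `k ≤ K`, term level `i ≤ k`; under `LocCover D κ₁ C′` (per fine
site), `EnlBounded D M₁ r` (print's `X̃`; `r ≥ 0`, `M₁ ≥ 1`, `M₁ ∣ 2L^m`) and the BLOCK STRUCTURE of the listed level-`i` domains at the trivial history (`IsBlockUnion (M₁·L^i) Y`,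
[Balaban1985UV3] (24) p.262 «Localizations X are connected unions of big blocks» — INLINE, the (α)-socket has no such row), the level-`i` domains whose enlargement projects
onto a given level-`k` site `y` satisfy `Σ_Y e^{−κ₁𝓛(Y)} ≤ max C′ 0 · (7 + 2r + 18M₁)³ · L^{3(k−i)}` — the number of level-`i` big blocks under one level-`k` block up to the
collar, NOT the fine volume `L^{3k}` a per-fine-site reading of `LocCover` alone would give. [cite: Balaban1985UV3, (45)-(46) p.267] -/
theorem localCount_le (D : AlphaDataT3 F γ) {κ₁ C' r : ℝ} {M₁ : ℕ} (hLC : LocCover D κ₁ C') (hEnl : EnlBounded D M₁ r) (hr : 0 ≤ r)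
    (hM1 : 1 ≤ M₁) (hMdvd : M₁ ∣ 2 * F.L ^ F.m) {K k i : ℕ} (hk : k ≤ K) (hik : i ≤ k)
    (hBU : ∀ Y ∈ D.Loc K k (D.triv K k) i, IsBlockUnion (M₁ * F.L ^ i) Y) (y : Site (F.P K) k) :
    ∑ Y ∈ (D.Loc K k (D.triv K k) i).filter (fun Y => ∃ x ∈ D.enl K i Y, iterBlockOf k x = y), Real.exp (-κ₁ * D.treeLen K i Y) ≤
      max C' 0 * (7 + 2 * r + 18 * M₁) ^ 3 * (F.L : ℝ) ^ (3 * (k - i)) := by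
  classical
  set T := (D.Loc K k (D.triv K k) i).filter (fun Y => ∃ x ∈ D.enl K i Y, iterBlockOf k x = y) with hT
  have hL2 : (2 : ℝ) ≤ F.L := by exact_mod_cast F.hL.2
  have hL1 : (1 : ℝ) ≤ F.L := by linarith
  have hL0 : (0 : ℝ) < F.L := by linarith
  have hLn : 0 < F.L := by have := F.hL.2; omega
  have hM1' : (1 : ℝ) ≤ M₁ := by exact_mod_cast hM1
  have hB0 : (0 : ℝ) ≤ 7 + 2 * r + 18 * M₁ := by positivity
  have hrhs : 0 ≤ max C' 0 * (7 + 2 * r + 18 * M₁) ^ 3 * (F.L : ℝ) ^ (3 * (k - i)) := by positivity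
  -- empty family: nothing to count
  by_cases hne : T.Nonempty
  swap
  · rw [Finset.not_nonempty_iff_eq_empty.mp hne, Finset.sum_empty]; exact hrhs
  -- a centre: the enlargement witness of one member
  obtain ⟨Y₀, hY₀⟩ := hne
  obtain ⟨c, -, hc⟩ := (Finset.mem_filter.mp hY₀).2
  -- standing range and the dimension of the torus
  have hkK : k ≤ (F.P K).m + (F.P K).K := show k ≤ F.m + K by omega
  have hd : (F.P K).d = 3 := rfl
  -- the big-block side, the radius, the window
  set s : ℕ := M₁ * F.L ^ i with hs
  have hs0 : 0 < s := Nat.mul_pos (by omega) (pow_pos hLn i)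
  have hscast : (s : ℝ) = (M₁ : ℝ) * (F.L : ℝ) ^ i := by rw [hs]; push_cast; ring
  have hLik : (F.L : ℝ) ^ i ≤ (F.L : ℝ) ^ k := pow_le_pow_right₀ hL1 hik
  have hLk1 : (1 : ℝ) ≤ (F.L : ℝ) ^ k := one_le_pow₀ hL1
  set ρ : ℝ := (3 + r + 9 * M₁) * (F.L : ℝ) ^ k with hρ
  have hρ0 : 0 ≤ ρ := by positivity
  set S : Finset (Site (F.P K) 0) := ball c ⌊ρ⌋₊ with hS
  -- (a) the per-site cover, in the shape the double count wants
  have hcov : ∀ x : Site (F.P K) 0,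
      ∑ Y ∈ D.Loc K k (D.triv K k) i, Y.indicator (fun _ => Real.exp (-κ₁ * D.treeLen K i Y)) x ≤ max C' 0 :=
    fun x => (hLC.2 K k (D.triv K k) i x).trans (le_max_left _ _)
  -- (b) the volume: every member has a full big block inside the window
  have hvol : ∀ Y ∈ T, (s : ℝ) ^ 3 ≤ ∑ z ∈ S, Y.indicator (fun _ => (1 : ℝ)) z := by
    intro Y hY
    obtain ⟨hYloc, x', hx', hx'y⟩ := Finset.mem_filter.mp hY
    obtain ⟨x, hxY, hbd⟩ := hEnl K i Y x' hx'
    -- the big block of `x` lies in `Y`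
    have hcubeY : ∀ z : Site (F.P K) 0, cubeIdx s z = cubeIdx s x → z ∈ Y := fun z hz => (hBU Y hYloc hz).mpr hxY
    -- … and inside the window
    have h1 : Site.tdist c x' ≤ 3 * (F.L ^ k - 1) := by
      have := tdist_le_of_iterBlockOf_eq hkK (hc.trans hx'y.symm)
      simpa [hd] using this
    have h2 : Site.tdist x' x ≤ blockDist (F.P K) 0 s x' x + 2 * (3 * s) := by
      have := tdist_le_blockDist_add' hs0 x' x
      simpa [hd] using this
    have hbd' : (blockDist (F.P K) 0 s x' x : ℝ) ≤ r * (F.L : ℝ) ^ i := by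
      have h : (blockDist (F.P K) 0 (M₁ * F.L ^ i) x' x : ℝ) / (F.L : ℝ) ^ i ≤ r := hbd
      rwa [div_le_iff₀ (pow_pos hL0 i)] at h
    have hcubeS : ∀ z : Site (F.P K) 0, cubeIdx s z = cubeIdx s x → z ∈ S := by
      intro z hz
      rw [hS, mem_ball]
      apply Nat.le_floor
      have h3 : Site.tdist x z ≤ 3 * (s - 1) := by
        have := tdist_le_of_cubeIdx_eq hs0 hz.symm
        simpa [hd] using this
      have htri : Site.tdist c z ≤ Site.tdist c x' + (Site.tdist x' x + Site.tdist x z) :=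
        (tdist_triangle c x' z).trans (Nat.add_le_add_left (tdist_triangle x' x z) _)
      have h1' : (Site.tdist c x' : ℝ) ≤ 3 * (F.L : ℝ) ^ k := by
        have : Site.tdist c x' ≤ 3 * F.L ^ k := h1.trans (Nat.mul_le_mul_left _ (Nat.sub_le _ _))
        exact_mod_cast this
      have h2' : (Site.tdist x' x : ℝ) ≤ r * (F.L : ℝ) ^ i + 6 * s := by
        have : (Site.tdist x' x : ℝ) ≤ (blockDist (F.P K) 0 s x' x : ℝ) + 2 * (3 * s) := by exact_mod_cast h2
        linarith
      have h3' : (Site.tdist x z : ℝ) ≤ 3 * s := by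
        have : Site.tdist x z ≤ 3 * s := h3.trans (Nat.mul_le_mul_left _ (Nat.sub_le _ _))
        exact_mod_cast this
      have htri' : (Site.tdist c z : ℝ) ≤ Site.tdist c x' + (Site.tdist x' x + Site.tdist x z) := by exact_mod_cast htri
      have hsM : (s : ℝ) ≤ (M₁ : ℝ) * (F.L : ℝ) ^ k := by rw [hscast]; exact mul_le_mul_of_nonneg_left hLik (by positivity)
      have hri : r * (F.L : ℝ) ^ i ≤ r * (F.L : ℝ) ^ k := mul_le_mul_of_nonneg_left hLik hr
      calc (Site.tdist c z : ℝ) ≤ 3 * (F.L : ℝ) ^ k + (r * (F.L : ℝ) ^ i + 6 * s) + 3 * s := by linarith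
        _ ≤ 3 * (F.L : ℝ) ^ k + r * (F.L : ℝ) ^ k + 9 * ((M₁ : ℝ) * (F.L : ℝ) ^ k) := by linarith
        _ = ρ := by rw [hρ]; ring
    -- count the big block
    calc (s : ℝ) ^ 3 = ((s ^ (F.P K).d : ℕ) : ℝ) := by rw [hd]; push_cast; ring
      _ ≤ ((fiber s (cubeIdx s x) : Finset (Site (F.P K) 0)).card : ℝ) := by
          exact_mod_cast pow_le_card_fiber hs0 (bigBlock_dvd_period hMdvd (hik.trans hk)) x
      _ = ∑ z ∈ (fiber s (cubeIdx s x) : Finset (Site (F.P K) 0)), Y.indicator (fun _ => (1 : ℝ)) z := by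
          rw [Finset.sum_congr rfl fun z hz => Set.indicator_of_mem (hcubeY z (mem_fiber.mp hz)) (fun _ => (1 : ℝ))]
          simp
      _ ≤ ∑ z ∈ S, Y.indicator (fun _ => (1 : ℝ)) z :=
          Finset.sum_le_sum_of_subset_of_nonneg (fun z hz => hcubeS z (mem_fiber.mp hz))
            fun z _ _ => Set.indicator_nonneg (fun _ _ => zero_le_one) z
  -- (c) double counting on the window
  have hT' : T ⊆ D.Loc K k (D.triv K k) i := Finset.filter_subset _ _
  have hs3 : (0 : ℝ) < (s : ℝ) ^ 3 := by positivity
  have hmain := sum_le_of_local_volume (D.Loc K k (D.triv K k) i) T hT' (fun Y => Real.exp (-κ₁ * D.treeLen K i Y))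
    (fun _ => Real.exp_nonneg _) S hs3 hvol hcov
  refine hmain.trans ?_
  -- (d) the window has at most `(2ρ + 1)³ ≤ ((7 + 2r + 18M₁)L^k)³` sites, the big block has `M₁³L^{3i} ≥ L^{3i}`
  have hScard : (S.card : ℝ) ≤ (2 * ρ + 1) ^ 3 := by
    have := card_ball_floor_le c hρ0
    simpa [hS, hd] using this
  have hρB : 2 * ρ + 1 ≤ (7 + 2 * r + 18 * M₁) * (F.L : ℝ) ^ k := by rw [hρ]; nlinarith
  have hS3 : (S.card : ℝ) ≤ (7 + 2 * r + 18 * M₁) ^ 3 * (F.L : ℝ) ^ (3 * k) := by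
    calc (S.card : ℝ) ≤ (2 * ρ + 1) ^ 3 := hScard
      _ ≤ ((7 + 2 * r + 18 * M₁) * (F.L : ℝ) ^ k) ^ 3 := pow_le_pow_left₀ (by positivity) hρB 3
      _ = (7 + 2 * r + 18 * M₁) ^ 3 * (F.L : ℝ) ^ (3 * k) := by rw [mul_pow, ← pow_mul, mul_comm k 3]
  have hs3low : (F.L : ℝ) ^ (3 * i) ≤ (s : ℝ) ^ 3 := by
    rw [hscast, mul_pow, ← pow_mul, mul_comm i 3]
    exact le_mul_of_one_le_left (by positivity) (one_le_pow₀ hM1')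
  have hsplit : (F.L : ℝ) ^ (3 * k) = (F.L : ℝ) ^ (3 * (k - i)) * (F.L : ℝ) ^ (3 * i) := by
    rw [← pow_add]; congr 1; omega
  rw [div_le_iff₀ hs3]
  calc max C' 0 * (S.card : ℝ) ≤ max C' 0 * ((7 + 2 * r + 18 * M₁) ^ 3 * (F.L : ℝ) ^ (3 * k)) :=
        mul_le_mul_of_nonneg_left hS3 (le_max_right _ _)
    _ = max C' 0 * (7 + 2 * r + 18 * M₁) ^ 3 * (F.L : ℝ) ^ (3 * (k - i)) * (F.L : ℝ) ^ (3 * i) := by rw [hsplit]; ring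
    _ ≤ max C' 0 * (7 + 2 * r + 18 * M₁) ^ 3 * (F.L : ℝ) ^ (3 * (k - i)) * (s : ℝ) ^ 3 :=
        mul_le_mul_of_nonneg_left hs3low hrhs

end Cover

/-! ## §5 The `cover` shape of the (m2) door's activity system -/

section CoverShape

variable {F : T3Family} {γ : ℝ}

/-- The weight-count product at one level: `(L^{−(k−i)})⁴ · L^{3(k−i)} = (L⁻¹)^{k−i}` — (44)'s `(Lʲη)⁴` against (46)'s block count. [cite: Balaban1985UV3, (44)-(46) p.267] -/
theorem inv_pow_four_mul_pow_three {L : ℝ} (hL : 0 < L) (t : ℕ) : ((L ^ t)⁻¹) ^ 4 * L ^ (3 * t) = (L⁻¹) ^ t := by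
  have ha : (L ^ t : ℝ) ≠ 0 := (pow_pos hL t).ne'
  rw [pow_mul', inv_pow L t, show (4 : ℕ) = 3 + 1 by rfl, pow_succ', mul_assoc, ← mul_pow, inv_mul_cancel₀ ha, one_pow, mul_one]

open Classical in
/-- ★★★ **`Witness.cover`'s SHAPE FOR THE (α)-SOCKET's ACTIVITY SYSTEM AT THE TRIVIAL HISTORY** (run `K`, level `k ≤ K`; the domain index of ✓`activitySystem_of_alpha` =
the tagged pairs `⟨i, Y⟩`, `i ∈ [1, k]`, `Y ∈ Loc K k triv i`; footprint of `⟨i, Y⟩` = the level-`k` sites under the enlargement `enl K i Y`; size weight `(L^{−(k−i)})⁴`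
times a level-independent constant left to the consumer): under `LocCover D κ₁ C′`, `EnlBounded D M₁ r` (`r ≥ 0`, `1 ≤ M₁`, `M₁ ∣ 2L^m`) and the block structure of every
listed domain at the trivial history ([Balaban1985UV3] (24) p.262, INLINE as `IsBlockUnion (M₁·L^i) Y`), for EVERY level-`k` site `y`:
`Σ_{⟨i,Y⟩ : y under enl Y} (L^{−(k−i)})⁴·e^{−κ₁𝓛(Y)} ≤ 2 · max C′ 0 · (7 + 2r + 18M₁)³` — (45)–(46) p.267 read per FOOTPRINT SITE: `Σ_i (Lⁱη)⁴ × #{level-i blocks under one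
level-k block} ≍ Σ_i L^{−(k−i)} ≤ 2`, uniformly in `k`, `K` and the history-free data. Multiply by `max C 0 · θBal(K−k+1)²` (✓`activitySystem_of_alpha`'s `wt`) to get the
door's `Ccov`. [cite: Balaban1985UV3, (44)-(46) p.267] -/
theorem coverShape_of_alpha (D : AlphaDataT3 F γ) {κ₁ C' r : ℝ} {M₁ : ℕ} (hLC : LocCover D κ₁ C') (hEnl : EnlBounded D M₁ r) (hr : 0 ≤ r)
    (hM1 : 1 ≤ M₁) (hMdvd : M₁ ∣ 2 * F.L ^ F.m) {K k : ℕ} (hk : k ≤ K)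
    (hBU : ∀ i, 1 ≤ i → i ≤ k → ∀ Y ∈ D.Loc K k (D.triv K k) i, IsBlockUnion (M₁ * F.L ^ i) Y) (y : Site (F.P K) k) :
    ∑ x ∈ ((Finset.Icc 1 k).sigma (fun i => D.Loc K k (D.triv K k) i)).filter (fun x => ∃ z ∈ D.enl K x.1 x.2, iterBlockOf k z = y),
        (((F.L : ℝ) ^ (k - x.1))⁻¹) ^ 4 * Real.exp (-κ₁ * D.treeLen K x.1 x.2) ≤
      2 * max C' 0 * (7 + 2 * r + 18 * M₁) ^ 3 := by
  classical
  have hL2 : (2 : ℝ) ≤ F.L := by exact_mod_cast F.hL.2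
  have hL0 : (0 : ℝ) < F.L := by linarith
  set B : ℝ := max C' 0 * (7 + 2 * r + 18 * M₁) ^ 3 with hB
  have hB0 : 0 ≤ B := by positivity
  -- filter of a sigma-sum, level by level
  rw [Finset.sum_filter, Finset.sum_sigma]
  -- each level: `(L^{−(k−i)})⁴ · (local count) ≤ B·(L⁻¹)^{k−i}`
  have hlev : ∀ i ∈ Finset.Icc 1 k,
      ∑ Y ∈ D.Loc K k (D.triv K k) i,
          (if ∃ z ∈ D.enl K i Y, iterBlockOf k z = y then (((F.L : ℝ) ^ (k - i))⁻¹) ^ 4 * Real.exp (-κ₁ * D.treeLen K i Y) else 0) ≤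
        B * ((F.L : ℝ)⁻¹) ^ (k - i) := by
    intro i hi
    rw [Finset.mem_Icc] at hi
    rw [← Finset.sum_filter, ← Finset.mul_sum]
    have hcnt := localCount_le D hLC hEnl hr hM1 hMdvd hk hi.2 (hBU i hi.1 hi.2) y
    have hw0 : (0 : ℝ) ≤ (((F.L : ℝ) ^ (k - i))⁻¹) ^ 4 := by positivity
    calc (((F.L : ℝ) ^ (k - i))⁻¹) ^ 4 *
          ∑ Y ∈ (D.Loc K k (D.triv K k) i).filter (fun Y => ∃ z ∈ D.enl K i Y, iterBlockOf k z = y), Real.exp (-κ₁ * D.treeLen K i Y)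
        ≤ (((F.L : ℝ) ^ (k - i))⁻¹) ^ 4 * (B * (F.L : ℝ) ^ (3 * (k - i))) := mul_le_mul_of_nonneg_left (by rw [hB]; exact hcnt) hw0
      _ = B * ((((F.L : ℝ) ^ (k - i))⁻¹) ^ 4 * (F.L : ℝ) ^ (3 * (k - i))) := by ring
      _ = B * ((F.L : ℝ)⁻¹) ^ (k - i) := by rw [inv_pow_four_mul_pow_three hL0]
  calc ∑ i ∈ Finset.Icc 1 k, ∑ Y ∈ D.Loc K k (D.triv K k) i,
          (if ∃ z ∈ D.enl K (⟨i, Y⟩ : Σ _ : ℕ, Set (Site (F.P K) 0)).1 (⟨i, Y⟩ : Σ _ : ℕ, Set (Site (F.P K) 0)).2, iterBlockOf k z = y then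
            (((F.L : ℝ) ^ (k - (⟨i, Y⟩ : Σ _ : ℕ, Set (Site (F.P K) 0)).1))⁻¹) ^ 4 *
              Real.exp (-κ₁ * D.treeLen K (⟨i, Y⟩ : Σ _ : ℕ, Set (Site (F.P K) 0)).1 (⟨i, Y⟩ : Σ _ : ℕ, Set (Site (F.P K) 0)).2)
           else 0)
      ≤ ∑ i ∈ Finset.Icc 1 k, B * ((F.L : ℝ)⁻¹) ^ (k - i) := Finset.sum_le_sum hlev
    _ = B * ∑ i ∈ Finset.Icc 1 k, ((F.L : ℝ)⁻¹) ^ (k - i) := by rw [Finset.mul_sum]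
    _ ≤ B * 2 := mul_le_mul_of_nonneg_left (sum_Icc_inv_pow_sub_le_two hL2 k) hB0
    _ = 2 * max C' 0 * (7 + 2 * r + 18 * M₁) ^ 3 := by rw [hB]; ring

end CoverShape

end Summit.QuantumFields.YangMills.Theorems.FluctuationComparisonRegPrIntLS1aAlphaLocalCover

end
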